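import Literature.NumberTheory.Automorphic.ArchRankOneOrbitalFamilyParam   -- ★ (B-par) (F0P3a-p04 (g24)): `contDiff_coe_circleDiagonal_torusPoint`, one-place pattern; brings ★ `torusPoint_ne`, `isCompact_setOf_coe_archLocal_mem`, `isCompact_setOf_exists_conj_circleDiagonal_mem`, Hörmander ★ `contDiffAt_integral_comp_of_contDiff_of_support`
import Mathlib.MeasureTheory.Constructions.Pi
import HarnessLib

/-!
# The multi-place normalised elliptic orbital object `(x, ψ) ↦ (∏_i 2 sin ψ_i) • ∫_{Π_i G_i} Θ_x((h_i t_{z_i}(ψ_i) h_i⁻¹)_i) d(⊗_i ν_i)` is jointly `C^∞` off the walls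
# (Varadarajan 1977 I §1.12 «invariant integrals depending smoothly on parameters»; Hörmander Thm. 1.1.9; Rogawski 1990 §8.2)

Topic `NumberTheory/Automorphic`; namespace `Literature.NumberTheory.Automorphic.RankOneCasimir`.  THEOREMS ONLY (no `def`, no instance, no notation, no axiom, no named fact,
no `sorry`); kernel lane `--kind proof --supports stmt-HodgeConjecture-24833`.  Cell `pub/hodgecm-mathlib`, crux H413 (`stmt-HodgeConjecture-24833`), line LH3 (closer stub `stub_N9`,
direct road), letter L3′ organ O-L3′ conjunct (ii) for GENERAL `fH`, (α4) «all-orders transport», stage **(α4-S6) «MULTI-WALL base points `|P₀| ≥ 2`»** (LH3-plan (g3) 10:09:22Z; design memo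
`F0/P3c/LH10/LH10-p01/g4/s6/CENSUS-alpha4-S6.v2.md` + ADDENDUM v3), brick (S6-B5a) part 1.  Seat LH10-p01 (g4).  Count-neutral.

THE MATHEMATICS.  Fix finitely many wall places `wl : ι → {w // IsComplex w}` of the CM field `L`, at each the rank-one elliptic frame of ★ (ELL-∞)∕(B-par): `G_i = U(σ_{wl i} diag a)(ℂ)`
(`a : Fin 2 → L`, `a_j ≠ 0`, any signature), a measure `ν_i` finite on compacts, a centre `z_i ∈ S¹` and the torus curve `t_{z_i}(ψ) = diag(z_i e^{iψ}, z_i e^{−iψ})`.  For a jointly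
smooth FAMILY `Θ : X → (ι → M₂(ℂ)) → E` (`X` finite-dimensional: the smooth parameters — the other coordinates, the next place's matrix variable, …) with ONE compact support `C ⊆ (ι → M₂(ℂ))`
uniform in `x`, the ι-FOLD NORMALISED OBJECT
  `𝓕 Θ (x, ψ) := (∏ i, 2 sin (ψ i)) • ∫ h : (Π i, G_i), Θ x (fun i => ↑↑(h i · t_{z_i}(ψ i) · (h i)⁻¹)) ∂(Measure.pi ν)`
is `C^∞` JOINTLY in `(x, ψ)` on `univ ×ˢ {ψ | ∀ i, sin (ψ i) ≠ 0}` (**`contDiffOn_multiOrbitalIntegral_param`**): near a regular `ψ₀` the integrand vanishes off ONE compact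
`Π_i S_i ⊆ Π_i G_i` (per place ★ `isCompact_setOf_exists_conj_circleDiagonal_mem` over a compact regular arc, ★ `torusPoint_ne`, ★ `isCompact_setOf_coe_archLocal_mem`;
`exists_isCompact_forall_apply_conj_multiTorusPoint_eq_zero`), the integrand is ONE jointly smooth function of the datum `((↑↑h_i)_i, (↑↑h_i⁻¹)_i)` and `(x, ψ)`, and the Hörmander
engine ★ `contDiffAt_integral_comp_of_contDiff_of_support` applies against the product measure.  This is the ι-place twin of ★ (B-par) `contDiffOn_orbitalIntegral_param` and the
regular-open-box smoothness that the (α4-S6) induction (invariant `Inv ι`: JOINT `(ψ, x)`-jet bounds on each open sign-cube) differentiates.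
HONEST LABEL: HC_CM is proved only modulo the 7 printed citations (2 remaining: hLiu418 = `stmt-HodgeConjecture-24832`, h413 = `stmt-HodgeConjecture-24833`) until rung 0 closes;
smoothness bookkeeping over ★ engines, count-neutral, pays nothing by itself.

## References
* [Varadarajan1977] V. S. Varadarajan, *Harmonic Analysis on Real Reductive Groups*, LNM 576 (1977), Part I §1.12.
* [HormanderALPDO1] L. Hörmander, *The Analysis of Linear Partial Differential Operators I*, 2nd ed. (1990), §1.1 Thm. 1.1.9.
* [Rogawski1990] J. D. Rogawski, *Automorphic Representations of Unitary Groups in Three Variables*, Ann. of Math. Stud. 123 (1990), §8.2 pp. 119–123.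
* [Bouaziz1994IntegralesOrbitales] A. Bouaziz, *Intégrales orbitales sur les groupes de Lie réductifs*, Ann. Sci. ÉNS 27 (1994), §3.1 (I₂).
-/

set_option autoImplicit false

noncomputable section

namespace Literature.NumberTheory.Automorphic.RankOneCasimir

open _root_.Complex _root_.Matrix _root_.MeasureTheory _root_.Set _root_.Filter _root_.Topology _root_.NumberField _root_.NumberField.InfinitePlace
open _root_.Literature.NumberTheory.Automorphic _root_.Literature.NumberTheory.Automorphic.UnitaryGroup _root_.Literature.Analysis.Calculus
open scoped Matrix.Norms.Operator MatrixGroups ComplexConjugate ContDiff Real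

variable (L : Type) [Field L] (a : Fin 2 → L) {ι : Type} [Fintype ι] (wl : ι → {w : InfinitePlace L // IsComplex w}) (z : ι → Circle)
variable {E : Type*} [NormedAddCommGroup E] [NormedSpace ℝ E] [CompleteSpace E]
variable {X : Type*} [NormedAddCommGroup X] [NormedSpace ℝ X] [FiniteDimensional ℝ X]

omit [NormedSpace ℝ E] [CompleteSpace E] [NormedSpace ℝ X] [FiniteDimensional ℝ X] in
/-- **UNIFORM COMPACT SUPPORT NEAR A REGULAR POINT OF THE CUBE.**  `Θ : X → (ι → M₂(ℂ)) → E` vanishing off one compact `C` for every parameter, `sin (ψ₀ i) ≠ 0` for all `i`: there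
are a neighbourhood `W` of `(x₀, ψ₀)` and ONE compact `S ⊆ Π_i G_i` with `Θ x ((↑↑(h i · t_{z_i}(ψ i) · (h i)⁻¹))_i) = 0` for all `h ∉ S`, `(x, ψ) ∈ W` (per place ★
`isCompact_setOf_exists_conj_circleDiagonal_mem` over the compact regular arc `{t_{z_i}(ψ) : |ψ − ψ₀ i| ≤ δ_i}`; `S = Π_i S_i`, `isCompact_univ_pi`). [cite: Varadarajan1977, I §1.12]
[cite: Rogawski1990, §8.2 p. 122] -/
theorem exists_isCompact_forall_apply_conj_multiTorusPoint_eq_zero (ha : ∀ j, a j ≠ 0) (Θ : X → (ι → Matrix (Fin 2) (Fin 2) ℂ) → E)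
    {C : Set (ι → Matrix (Fin 2) (Fin 2) ℂ)} (hC : IsCompact C) (h0 : ∀ (x : X) (W : ι → Matrix (Fin 2) (Fin 2) ℂ), W ∉ C → Θ x W = 0)
    (p₀ : X × (ι → ℝ)) (hp₀ : ∀ i, Real.sin (p₀.2 i) ≠ 0) :
    ∃ W ∈ 𝓝 p₀, ∃ S : Set (∀ i, unitaryGroupOfForm (starRingEnd ℂ) ((Matrix.diagonal a).map (wl i).1.embedding)), IsCompact S ∧
      ∀ h ∉ S, ∀ p ∈ W, Θ p.1 (fun i => (((h i * ⟨circleDiagonal 2 ![z i * Circle.exp (p.2 i), z i * Circle.exp (-(p.2 i))],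
          circleDiagonal_mem_archLocal_diagonal L 2 a (wl i) _⟩ * (h i)⁻¹ :
        unitaryGroupOfForm (starRingEnd ℂ) ((Matrix.diagonal a).map (wl i).1.embedding)) : GL (Fin 2) ℂ) : Matrix (Fin 2) (Fin 2) ℂ)) = 0 := by
  have hopen : IsOpen {ψ : ℝ | Real.sin ψ ≠ 0} := isOpen_ne_fun Real.continuous_sin continuous_const
  -- per place: a closed ball of regular angles, the compact regular arc, the compact conjugating set
  have hδ : ∀ i, ∃ δ > 0, Metric.closedBall (p₀.2 i) δ ⊆ {ψ : ℝ | Real.sin ψ ≠ 0} := fun i => by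
    obtain ⟨ε, hε, hεball⟩ := Metric.mem_nhds_iff.1 (hopen.mem_nhds (show p₀.2 i ∈ {ψ : ℝ | Real.sin ψ ≠ 0} from hp₀ i))
    exact ⟨ε / 2, half_pos hε, (Metric.closedBall_subset_ball (half_lt_self hε)).trans hεball⟩
  choose δ hδ hball using hδ
  have htc : ∀ i, Continuous fun ψ : ℝ => (![z i * Circle.exp ψ, z i * Circle.exp (-ψ)] : Fin 2 → Circle) := fun i => by
    refine continuous_pi fun j => ?_
    fin_cases j
    · exact continuous_const.mul Circle.exp.continuous
    · exact continuous_const.mul (Circle.exp.continuous.comp continuous_neg)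
  have hKc : ∀ i, IsCompact ((fun ψ : ℝ => (![z i * Circle.exp ψ, z i * Circle.exp (-ψ)] : Fin 2 → Circle)) '' Metric.closedBall (p₀.2 i) (δ i)) := fun i =>
    (isCompact_closedBall _ _).image (htc i)
  have hKreg : ∀ i, (fun ψ : ℝ => (![z i * Circle.exp ψ, z i * Circle.exp (-ψ)] : Fin 2 → Circle)) '' Metric.closedBall (p₀.2 i) (δ i) ⊆
      {t : Fin 2 → Circle | Function.Injective t} := fun i => by
    rintro _ ⟨ψ, hψ, rfl⟩
    intro j k hjk
    fin_cases j <;> fin_cases k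
    · rfl
    · exact absurd hjk (torusPoint_ne (z i) (hball i hψ))
    · exact absurd hjk.symm (torusPoint_ne (z i) (hball i hψ))
    · rfl
  -- the `i`-th coordinate projection of `C`
  have hCi : ∀ i, IsCompact ((fun W : ι → Matrix (Fin 2) (Fin 2) ℂ => W i) '' C) := fun i => hC.image (continuous_apply i)
  have hC' := fun i => isCompact_setOf_coe_archLocal_mem L 2 a (wl i) ha (hCi i)
  have hS := fun i => isCompact_setOf_exists_conj_circleDiagonal_mem L 2 a (wl i) ha (hKc i) (hKreg i) (hC' i)
  -- `S = Π_i S_i`, left implicit (inferred from `hSpi`)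
  have hSpi := isCompact_univ_pi fun i => hS i
  refine ⟨(Set.univ : Set X) ×ˢ Set.pi Set.univ (fun i => Metric.closedBall (p₀.2 i) (δ i)), ?_, _, hSpi, fun h hh p hp => ?_⟩
  · exact prod_mem_nhds Filter.univ_mem (set_pi_mem_nhds Set.finite_univ fun i _ => Metric.closedBall_mem_nhds _ (hδ i))
  by_contra hne
  apply hh
  intro i _
  refine ⟨![z i * Circle.exp (p.2 i), z i * Circle.exp (-(p.2 i))], ⟨p.2 i, (Set.mem_prod.1 hp).2 i (Set.mem_univ i), rfl⟩, ?_⟩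
  show _ ∈ {g : archLocal L 2 (Matrix.diagonal a) (wl i) | ((g : GL (Fin 2) ℂ) : Matrix (Fin 2) (Fin 2) ℂ) ∈ (fun W : ι → Matrix (Fin 2) (Fin 2) ℂ => W i) '' C}
  have hW : (fun i => (((h i * ⟨circleDiagonal 2 ![z i * Circle.exp (p.2 i), z i * Circle.exp (-(p.2 i))],
          circleDiagonal_mem_archLocal_diagonal L 2 a (wl i) _⟩ * (h i)⁻¹ :
        unitaryGroupOfForm (starRingEnd ℂ) ((Matrix.diagonal a).map (wl i).1.embedding)) : GL (Fin 2) ℂ) : Matrix (Fin 2) (Fin 2) ℂ)) ∈ C := by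
    by_contra hout
    exact hne (h0 p.1 _ hout)
  exact ⟨_, hW, rfl⟩

/-- **JOINT SMOOTHNESS OF THE MULTI-PLACE NORMALISED ELLIPTIC OBJECT OFF THE WALLS.**  With measures `ν_i` finite on compacts on the `G_i`, centres `z_i`, and a jointly smooth family
`Θ : X → (ι → M₂(ℂ)) → E` with one compact support `C`: **`(x, ψ) ↦ (∏ i, 2 sin (ψ i)) • ∫ Θ x ((↑↑(h i · t_{z_i}(ψ i) · (h i)⁻¹))_i) d(Measure.pi ν)` is `C^∞` on
`univ ×ˢ {ψ | ∀ i, sin (ψ i) ≠ 0}`** — Hörmander ★ `contDiffAt_integral_comp_of_contDiff_of_support` against the product measure, integrand `Θ x ((A i · t_{z_i}(ψ i) · B i)_i)` at the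
datum `(A, B) = ((↑↑h i)_i, (↑↑(h i)⁻¹)_i)`, uniform compact support from `exists_isCompact_forall_apply_conj_multiTorusPoint_eq_zero`; times the smooth scalar `∏ 2 sin`.
[cite: Varadarajan1977, I §1.12] [cite: HormanderALPDO1, Thm. 1.1.9] [cite: Rogawski1990, §8.2 pp. 122–123] -/
theorem contDiffOn_multiOrbitalIntegral_param (ha : ∀ j, a j ≠ 0)
    [∀ i, MeasurableSpace (unitaryGroupOfForm (starRingEnd ℂ) ((Matrix.diagonal a).map (wl i).1.embedding))]
    [∀ i, BorelSpace (unitaryGroupOfForm (starRingEnd ℂ) ((Matrix.diagonal a).map (wl i).1.embedding))]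
    (ν : ∀ i, Measure (unitaryGroupOfForm (starRingEnd ℂ) ((Matrix.diagonal a).map (wl i).1.embedding))) [∀ i, SigmaFinite (ν i)]
    [IsFiniteMeasureOnCompacts (Measure.pi ν)]
    (Θ : X → (ι → Matrix (Fin 2) (Fin 2) ℂ) → E) (hΘ : ContDiff ℝ ∞ (Function.uncurry Θ))
    (hΘc : ∃ C : Set (ι → Matrix (Fin 2) (Fin 2) ℂ), IsCompact C ∧ ∀ (x : X) (W : ι → Matrix (Fin 2) (Fin 2) ℂ), W ∉ C → Θ x W = 0) :
    ContDiffOn ℝ ∞ (fun p : X × (ι → ℝ) => (∏ i, 2 * Real.sin (p.2 i)) •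
      ∫ h : (∀ i, unitaryGroupOfForm (starRingEnd ℂ) ((Matrix.diagonal a).map (wl i).1.embedding)),
        Θ p.1 (fun i => (((h i * ⟨circleDiagonal 2 ![z i * Circle.exp (p.2 i), z i * Circle.exp (-(p.2 i))],
            circleDiagonal_mem_archLocal_diagonal L 2 a (wl i) _⟩ * (h i)⁻¹ :
          unitaryGroupOfForm (starRingEnd ℂ) ((Matrix.diagonal a).map (wl i).1.embedding)) : GL (Fin 2) ℂ) : Matrix (Fin 2) (Fin 2) ℂ)) ∂(Measure.pi ν))
      ((Set.univ : Set X) ×ˢ {ψ : ι → ℝ | ∀ i, Real.sin (ψ i) ≠ 0}) := by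
  obtain ⟨C, hC, h0⟩ := hΘc
  intro p₀ hp₀
  have hp₀' : ∀ i, Real.sin (p₀.2 i) ≠ 0 := (Set.mem_prod.1 hp₀).2
  refine ContDiffAt.contDiffWithinAt ?_
  -- the jointly smooth integrand on the datum space `(ι → M₂) × (ι → M₂)` and the parameter space `X × (ι → ℝ)`
  set Ψ : ((ι → Matrix (Fin 2) (Fin 2) ℂ) × (ι → Matrix (Fin 2) (Fin 2) ℂ)) × (X × (ι → ℝ)) → E :=
    fun q => Θ q.2.1 (fun i => q.1.1 i * ((circleDiagonal 2 ![z i * Circle.exp (q.2.2 i), z i * Circle.exp (-(q.2.2 i))] : GL (Fin 2) ℂ) : Matrix (Fin 2) (Fin 2) ℂ) * q.1.2 i)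
    with hΨ
  have hΨd : ContDiff ℝ ∞ Ψ := by
    refine hΘ.comp ((contDiff_fst.comp contDiff_snd).prodMk (contDiff_pi.2 fun i => ?_))
    exact (((contDiff_apply ℝ (Matrix (Fin 2) (Fin 2) ℂ) i).comp (contDiff_fst.comp contDiff_fst)).mul
      ((contDiff_coe_circleDiagonal_torusPoint (z i)).comp ((contDiff_apply ℝ ℝ i).comp (contDiff_snd.comp contDiff_snd)))).mul
      ((contDiff_apply ℝ (Matrix (Fin 2) (Fin 2) ℂ) i).comp (contDiff_snd.comp contDiff_fst))
  set y : (∀ i, unitaryGroupOfForm (starRingEnd ℂ) ((Matrix.diagonal a).map (wl i).1.embedding)) →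
      (ι → Matrix (Fin 2) (Fin 2) ℂ) × (ι → Matrix (Fin 2) (Fin 2) ℂ) :=
    fun h => (fun i => (((h i : unitaryGroupOfForm (starRingEnd ℂ) ((Matrix.diagonal a).map (wl i).1.embedding)) : GL (Fin 2) ℂ) : Matrix (Fin 2) (Fin 2) ℂ),
      fun i => ((((h i)⁻¹ : unitaryGroupOfForm (starRingEnd ℂ) ((Matrix.diagonal a).map (wl i).1.embedding)) : GL (Fin 2) ℂ) : Matrix (Fin 2) (Fin 2) ℂ)) with hy
  have hyc : Continuous y := by
    refine (continuous_pi fun i => ?_).prodMk (continuous_pi fun i => ?_)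
    · exact (Units.continuous_val.comp continuous_subtype_val).comp (continuous_apply i)
    · exact ((Units.continuous_val.comp continuous_subtype_val).comp continuous_inv).comp (continuous_apply i)
  have hΨy : ∀ (h : ∀ i, unitaryGroupOfForm (starRingEnd ℂ) ((Matrix.diagonal a).map (wl i).1.embedding)) (p : X × (ι → ℝ)), Ψ (y h, p) =
      Θ p.1 (fun i => (((h i * ⟨circleDiagonal 2 ![z i * Circle.exp (p.2 i), z i * Circle.exp (-(p.2 i))],
            circleDiagonal_mem_archLocal_diagonal L 2 a (wl i) _⟩ * (h i)⁻¹ :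
          unitaryGroupOfForm (starRingEnd ℂ) ((Matrix.diagonal a).map (wl i).1.embedding)) : GL (Fin 2) ℂ) : Matrix (Fin 2) (Fin 2) ℂ)) := fun h p => by
    simp only [hΨ, hy, Subgroup.coe_mul, Units.val_mul]
  -- uniform compact support near `p₀` and the Hörmander engine against the product measure (the finite product of second-countable Borel groups is Borel)
  haveI : ∀ i, SecondCountableTopology (unitaryGroupOfForm (starRingEnd ℂ) ((Matrix.diagonal a).map (wl i).1.embedding)) := fun i =>
    secondCountableTopology_archLocal L 2 (Matrix.diagonal a) (wl i)
  obtain ⟨W, hW, S, hS, hS0⟩ := exists_isCompact_forall_apply_conj_multiTorusPoint_eq_zero L a wl z ha Θ hC h0 p₀ hp₀'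
  have key := contDiffAt_integral_comp_of_contDiff_of_support (Measure.pi ν) Ψ hΨd y hyc p₀ hS hW (fun h hh p hp => by rw [hΨy]; exact hS0 h hh p hp)
  have hfun : (fun p : X × (ι → ℝ) => (∏ i, 2 * Real.sin (p.2 i)) •
      ∫ h : (∀ i, unitaryGroupOfForm (starRingEnd ℂ) ((Matrix.diagonal a).map (wl i).1.embedding)),
        Θ p.1 (fun i => (((h i * ⟨circleDiagonal 2 ![z i * Circle.exp (p.2 i), z i * Circle.exp (-(p.2 i))],
            circleDiagonal_mem_archLocal_diagonal L 2 a (wl i) _⟩ * (h i)⁻¹ :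
          unitaryGroupOfForm (starRingEnd ℂ) ((Matrix.diagonal a).map (wl i).1.embedding)) : GL (Fin 2) ℂ) : Matrix (Fin 2) (Fin 2) ℂ)) ∂(Measure.pi ν)) =
      fun p => (∏ i, 2 * Real.sin (p.2 i)) • ∫ h, Ψ (y h, p) ∂(Measure.pi ν) := by
    funext p
    exact congrArg _ (integral_congr_ae (Eventually.of_forall fun h => (hΨy h p).symm))
  rw [hfun]
  have hsin : ContDiff ℝ ∞ (fun p : X × (ι → ℝ) => ∏ i, 2 * Real.sin (p.2 i)) :=
    contDiff_prod (fun i _ => contDiff_const.mul (Real.contDiff_sin.comp ((contDiff_apply ℝ ℝ i).comp contDiff_snd)))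
  exact hsin.contDiffAt.smul key

end Literature.NumberTheory.Automorphic.RankOneCasimir

end
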